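import Summits.QuantumFields.YangMills.Theorems.FluctuationComparisonRegPrIntLS1aAlphaMemOfRows
import HarnessLib

/-!
# S1a · UV3-NODE §69 — THE (m2) DOOR FOR A VERSION OF THE DENSITY: «(α)-socket ⟹ `BalabanUVClass.Mem`» for ANY non-negative, measurable, gauge-invariant `ρ` obeying
# (47′)∕(41′) POINTWISE ON THE WINDOW — the form px17 g20's one-version door (✓p820698 `…S1aInvariantVersion` ∕ ✓p821154 `…S1aTowerLawInvariance`) feeds (δ7∕δ11 honest)

Cell `ym3-torus` (YM ladder rung R3 = continuum `SU(2)` Yang–Mills on the three-torus — a RUNG: NOT d = 4, NOT infinite volume, NOT a mass gap, NOT Clay).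
Width seat «width 8» `ym3-torus-px8` (gen 23), FREE px helper on crux `stmt-QuantumFields-20520`, count-neutral, DEFINITION-FREE, default heartbeats; companion of ✓p821956
`…S1aAlphaMemOfRows.mem_of_alphaRows` (the (m2) door assembled for `resDensity` itself).

WHY THIS EDITION.  `resDensity F γ K univ k` is a Radon–Nikodym transport (`T4FiniteEpsInhabited.rtOpIOfAC` ∕ `rnTransport`): ONE measurable version fixed by Mathlib's
Lebesgue decomposition.  Its POINTWISE gauge invariance (✓p821956's binder `hGI`, UV3-NODE §69.2 δ11) and the POINTWISE sandwich `Ineq41At`∕`Ineq47At` (δ7; the (α) package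
carries only `Ineq41AE`∕`Ineq47AE`, `T3AlphaInputsAC` §7) are therefore NOT dischargeable for that version — they are for a CHOSEN version: px17 g20's
`canonVersion dU (orbAvg ρ₀)` is gauge invariant POINTWISE with no hypothesis (✓`gaugeInvariant_canonVersion_orbAvg`) and turns a.e. bounds by functions continuous on an open
window into pointwise ones (✓`le_canonVersion_orbAvg_on` ∕ ✓`canonVersion_orbAvg_le_on`).  This file states the door for ANY such version, with (47′)∕(41′) in the socket's own
letters as binders ON THE WINDOW ONLY (`Witness.lower`∕`upper` ask no more), every other binder exactly as in ✓p821956.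

WHAT — ★★★ `mem_version_of_alphaRows`: `BalabanUVClass.Mem (blockAvg ℰp) prm (fun W => e^{E_k}·ρ W)` with ✓p821956's explicit `prm`, from the typed (α) schemas (`IsLocal`,
`GaugeInv26`, `TermSize`, `PintDecomp`, `AdmOnSmall`, `LocCover`, `EnlBounded`, `LocBlockVolume`, `MainTermIsAction`, `ChiRange`, `LFSum`), the version's `ρ ≥ 0`, `Measurable ρ`,
`GaugeInvariant ρ`, `h47ρ`∕`h41ρ` on the `θBal(K−k)`-window, the displayed rows (`hχ1` δ8, `hR0`, `hZ`, `hBU` δ1, `hDiam` δ4, `hsub` X ⊂ X̃), the displayed UNPRINTED δ2-b `hRegClass`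
(G-K1a-1, RULING №82 (2); removed by δ2-a via ✓p821267), and the LF debt `hlfle`∕`hlarge` for `e^{E_k}·ρ`.  Fields by name from ✓p819182 ∕ ✓p821836 ∕ ✓p821837 (the sandwich
algebra of ✓p820217 redone inline for the generic `ρ`).

WHAT THIS FILE IS NOT: a discharge of any binder; a choice of version; `MemOfRun`∕S1a (m) (height currency = (R-β1′)); nothing of Bałaban's asserted or proved; crux 20520,
19936, 19200, `YM3TorusSU2` NOT proved; no registered stub closed; rung R3 = SU(2) YM₃ on T³ — NOT d = 4, NOT infinite volume, NOT a mass gap, NOT Clay.  Sorry-free, axioms standard.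

References: T. Bałaban, CMP **102** (1985) 255–275 [Balaban1985UV3] ((24)–(26) pp.262–263, (41)–(47) pp.266–267); CMP **98** (1985) 17–51 [Balaban1985Averaging] ((12)–(13) p.19).
-/

set_option autoImplicit false

noncomputable section

namespace Summit.QuantumFields.YangMills.Theorems.FluctuationComparisonRegPrIntLS1aAlphaMemVersionOfRows

open Finset MeasureTheory
open scoped BigOperators
open Literature.MathematicalPhysics.QuantumFieldTheory.Balaban1983to89
open T3ContinuumYM3Torus T3UnitScaleTilt T3UnitLawDensityEML T3RestrictedUnitDensity T3AlphaInputsAC T3AlphaInputsACSchemas BalabanUVClass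
open T3AlphaInputsACTwoRunLevel (LocBlockVolume)
open B10Eq42TorusConstraint (bondsIn mem_bondsIn_iff)
open B10Eq38TorusDomains (IsBlockUnion bdist)
open B5Eq118OneStroke (iterBlockOf)
open Summit.QuantumFields.YangMills.Theorems.FluctuationComparisonRegPrIntLS1aAlphaActivitySystem (sum_equivFin_symm_eq)
open Summit.QuantumFields.YangMills.Theorems.FluctuationComparisonRegPrIntLS1aAlphaLocalCover (coverShape_of_alpha)
open Summit.QuantumFields.YangMills.Theorems.FluctuationComparisonRegPrIntLS1aAlphaFootDiam (diamFoot_le)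

variable {F : T3Family} {γ : ℝ}

/-! ## §1 The door for a version

HONEST NOTE on ✓p821956's binders `hGI` and `h41`∕`h47`: `resDensity` is a Radon–Nikodym transport (`T4FiniteEpsInhabited.rtOpIOfAC`, `rnTransport`), i.e. ONE measurable version
fixed by Mathlib's Lebesgue decomposition — POINTWISE gauge invariance (δ11) and the POINTWISE sandwich (δ7) are not dischargeable for THAT version (the (α) package carries
`Ineq41AE`∕`Ineq47AE`, §7 of `T3AlphaInputsAC`).  The dischargeable statement is about a CHOSEN version `ρ` (px17: `canonVersion dU (orbAvg ρ₀)`: pointwise invariant,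
a.e. bounds ⟹ pointwise on the window where `low`∕`up` have continuous representatives).  §2 states the door for any `ρ ≥ 0`, measurable, gauge invariant, obeying
(47′)∕(41′) POINTWISE ON THE WINDOW in the socket's letters — every other binder as in §1. -/

open Classical in
/-- ★★★ **THE (m2) DOOR FOR A VERSION** (run `K`, level `k ≤ K`): as `mem_of_alphaRows`, for ANY density `ρ` on level `k` of run `K` that is non-negative, measurable,
gauge invariant (δ11 — supplied for px17's version by ✓`…S1aInvariantVersion.gaugeInvariant_canonVersion_orbAvg`) and obeys the socket's (47′)∕(41′) POINTWISE ON THE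
`θBal(K−k)`-WINDOW (`h47ρ : e^{−E−Rm}·low ≤ ρ`, `h41ρ : ρ ≤ e^{−E+Rm}·up` there — δ7: supplied for that version by ✓`le_canonVersion_orbAvg_on`∕✓`canonVersion_orbAvg_le_on`
from `Ineq47AE`∕`Ineq41AE` once `low`∕`up` have continuous representatives on the window, §67.3 (c)); conclusion `Mem (blockAvg ℰp) prm (fun W => e^{E_k}·ρ W)` with
the SAME explicit `prm`.  The large-field clauses are stated for `e^{E_k}·ρ`. [cite: Balaban1985UV3, (41)-(47) pp.266-267 and (24)-(26) pp.262-263] -/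
theorem mem_version_of_alphaRows (D : AlphaDataT3 F γ) (Wd : LFData D) {b₀ p₀ C κ₁ C' r CD δreg δL cLF c5 : ℝ} {M₁ : ℕ} {K k : ℕ} (hk : k ≤ K)
    (ρ : GaugeField (F.P K) k (Matrix.specialUnitaryGroup (Fin 2) ℂ) → ℝ) (hρ0 : ∀ W, 0 ≤ ρ W) (hρm : Measurable ρ) (hρGI : GaugeField.GaugeInvariant ρ)
    -- typed (α) schemas
    (hloc : IsLocal D) (hgi : GaugeInv26 D) (hts : TermSize D b₀ p₀ C κ₁) (hdec : PintDecomp D) (hadm : AdmOnSmall D b₀ p₀)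
    (hLC : LocCover D κ₁ C') (hEnl : EnlBounded D M₁ r) (hBV : LocBlockVolume D)
    (hM : MainTermIsAction D) (hχ : ChiRange D) (hLF : LFSum D Wd)
    (hr : 0 ≤ r) (hM1 : 1 ≤ M₁) (hMdvd : M₁ ∣ 2 * F.L ^ F.m) (hCD : 0 ≤ CD)
    -- (47′)∕(41′) for THIS version, pointwise on the window (δ7)
    (h47ρ : ∀ W : GaugeField (F.P K) k (Matrix.specialUnitaryGroup (Fin 2) ℂ), PlaqSmall (θBal F.L γ b₀ p₀ (K - k)) W →
      Real.exp (-(D.Ecst K k) - D.Rm K k) * D.low K k W ≤ ρ W)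
    (h41ρ : ∀ W : GaugeField (F.P K) k (Matrix.specialUnitaryGroup (Fin 2) ℂ), PlaqSmall (θBal F.L γ b₀ p₀ (K - k)) W →
      ρ W ≤ Real.exp (-(D.Ecst K k) + D.Rm K k) * D.up K k W)
    -- rows the socket lacks (UV3-NODE §69.2 ∕ §69.9), displayed
    (hχ1 : ∀ W : GaugeField (F.P K) k (Matrix.specialUnitaryGroup (Fin 2) ℂ), PlaqSmall (θBal F.L γ b₀ p₀ (K - k)) W → D.χ K k W = 1)
    (hR0 : ∀ (W : GaugeField (F.P K) k (Matrix.specialUnitaryGroup (Fin 2) ℂ)) v, Wd.wt K k (Wd.trivReg K k) v W = D.χ K k W)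
    (hZ : D.Zterm K k (D.triv K k) = 0)
    (hBU : ∀ i, 1 ≤ i → i ≤ k → ∀ Y ∈ D.Loc K k (D.triv K k) i, IsBlockUnion (M₁ * F.L ^ i) Y)
    (hDiam : ∀ i, 1 ≤ i → i ≤ k → ∀ Y ∈ D.Loc K k (D.triv K k) i, ∀ x ∈ Y, ∀ y ∈ Y, bdist (F.P K) M₁ i x y ≤ CD * D.treeLen K i Y)
    (hsub : ∀ K i (Y : Set (Site (F.P K) 0)), Y ⊆ D.enl K i Y)
    -- δ2-b: UNPRINTED (UV3-NODE l.426 G-K1a-1); removed by δ2-a (RULING №82)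
    (hRegClass : ∀ W : GaugeField (F.P K) k (Matrix.specialUnitaryGroup (Fin 2) ℂ), PlaqSmall (θBal F.L γ b₀ p₀ (K - k)) W →
      IsBackground (fun i => BlockAveraging.blockAvg (P := F.P K) (j := i) ℰp) {U | PlaqSmall δreg U} k W (D.Umin K k (D.triv K k) W))
    -- the large-field debt (δ9–δ10 + [B82] §3.C), in `Witness` shape, for this version
    (hlfle : ∀ W : GaugeField (F.P K) k (Matrix.specialUnitaryGroup (Fin 2) ℂ),
      Real.exp (D.Ecst K k) * (Real.exp (-(D.Ecst K k) + D.Rm K k) * (D.up K k W - D.low K k W)) ≤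
        Real.exp (-cLF) * Real.exp (c5 * Fintype.card (Site (F.P K) k)))
    (hlarge : ∀ (W : GaugeField (F.P K) k (Matrix.specialUnitaryGroup (Fin 2) ℂ)) (S : Finset (Plaq (F.P K) k)),
      (∀ p ∈ S, δL ≤ GaugeGroup.dist1 (GaugeField.plaqHol W p)) →
        Real.exp (D.Ecst K k) * ρ W ≤ Real.exp (-(cLF * S.card)) * Real.exp (c5 * Fintype.card (Site (F.P K) k))) :
    Mem (P := F.P K) (k := k) (fun i => BlockAveraging.blockAvg (P := F.P K) (j := i) ℰp)
      { δ := θBal F.L γ b₀ p₀ (K - k), δreg := δreg, δL := δL, β := (F.scheme ℰp γ).β K, κ := κ₁, M := 2 * r + 18 * M₁ + 3 + CD,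
        Ccov := max C 0 * θBal F.L γ b₀ p₀ (K - k + 1) ^ 2 * (2 * max C' 0 * (7 + 2 * r + 18 * M₁) ^ 3), cE := 0, slack := D.Rm K k,
        cLF := cLF, c5 := c5 }
      (fun W => Real.exp (D.Ecst K k) * ρ W) := by
  classical
  -- the tagged domain index and its numbering (as ✓`activitySystem_of_alpha`)
  set s : Finset (Σ _ : ℕ, Set (Site (F.P K) 0)) := (Finset.Icc 1 k).sigma (fun i => D.Loc K k (D.triv K k) i) with hs
  set tag : Fin s.card → (Σ _ : ℕ, Set (Site (F.P K) 0)) := fun X => ((s.equivFin.symm X : s) : Σ _ : ℕ, Set (Site (F.P K) 0)) with htag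
  have htag_mem : ∀ X, tag X ∈ s := fun X => (s.equivFin.symm X).2
  have hlvl : ∀ X, 1 ≤ (tag X).1 ∧ (tag X).1 ≤ k ∧ (tag X).2 ∈ D.Loc K k (D.triv K k) (tag X).1 := fun X => by
    have h := htag_mem X
    rw [hs, Finset.mem_sigma, Finset.mem_Icc] at h
    exact ⟨h.1.1, h.1.2, h.2⟩
  -- constants
  set wt : Fin s.card → ℝ := fun X => max C 0 * θBal F.L γ b₀ p₀ (K - k + 1) ^ 2 * (((F.L : ℝ) ^ (k - (tag X).1))⁻¹) ^ 4 with hwt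
  have hwt0 : ∀ X, 0 ≤ wt X := fun X => by positivity
  -- the activity sum is `Pint` at the trivial history
  have hact : ∀ W : GaugeField (F.P K) k (Matrix.specialUnitaryGroup (Fin 2) ℂ),
      (∑ X : Fin s.card, D.Pterm K (tag X).1 (tag X).2 (D.Umin K k (D.triv K k) W)) = D.Pint K k (D.triv K k) W := fun W => by
    rw [hdec K k (D.triv K k) W]
    have h1 := sum_equivFin_symm_eq s (fun x => D.Pterm K x.1 x.2 (D.Umin K k (D.triv K k) W))
    change ∑ X : Fin s.card, D.Pterm K (tag X).1 (tag X).2 (D.Umin K k (D.triv K k) W) = _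
    rw [h1, hs, Finset.sum_sigma]
  -- `low ≤ up` everywhere (R0, Z0, `LFSum`), so `lf ≥ 0`
  have hlowup : ∀ W : GaugeField (F.P K) k (Matrix.specialUnitaryGroup (Fin 2) ℂ), D.low K k W ≤ D.up K k W := fun W => by
    have h := T3AlphaInputsACHistorySplit.low_mul_exp_le_up hLF (hR0 W)
    rwa [hZ, Real.exp_zero, mul_one] at h
  -- the witness
  refine ⟨{
    bg := fun W => D.Umin K k (D.triv K k) W
    nDom := s.card
    supp := fun X => bondsIn 0 (D.enl K (tag X).1 (tag X).2)
    foot := fun X => Finset.univ.filter (fun y => ∃ z ∈ D.enl K (tag X).1 (tag X).2, iterBlockOf k z = y)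
    len := fun X => D.treeLen K (tag X).1 (tag X).2
    wt := wt
    act := fun X => D.Pterm K (tag X).1 (tag X).2
    cst := 0
    lf := fun W => Real.exp (D.Ecst K k) * (Real.exp (-(D.Ecst K k) + D.Rm K k) * (D.up K k W - D.low K k W))
    nonneg := fun W => mul_nonneg (Real.exp_nonneg _) (hρ0 W)
    measurable := hρm.const_mul _
    gaugeInvariant := fun u W => by
      show Real.exp (D.Ecst K k) * ρ (GaugeField.gaugeAct u W) = Real.exp (D.Ecst K k) * ρ W
      rw [hρGI u W]
    isBackground := hRegClass
    foot_nonempty := ?_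
    supp_foot := ?_
    len_nonneg := fun X => hLC.1 K (tag X).1 (tag X).2
    wt_nonneg := hwt0
    diam_foot := ?_
    act_local := fun X U U' hUU' => hloc K (tag X).1 (tag X).2 U U' fun b hb => hUU' b hb
    act_gaugeInvariant := fun X => hgi K (tag X).1 (tag X).2
    act_bound := ?_
    cover := ?_
    cst_abs_le := by simp
    lower := ?_
    upper := ?_
    lf_nonneg := fun W => mul_nonneg (Real.exp_nonneg _) (mul_nonneg (Real.exp_nonneg _) (sub_nonneg.mpr (hlowup W)))
    lf_le := hlfle
    large := hlarge }⟩
  · intro X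
    obtain ⟨z, hz⟩ := T3AlphaInputsACTwoRunLevel.LocBlockVolume.nonempty hBV (hlvl X).2.2
    exact ⟨iterBlockOf k z, Finset.mem_filter.mpr ⟨Finset.mem_univ _, z, hsub K _ _ hz, rfl⟩⟩
  · intro X b hb
    have h1 : b.src ∈ D.enl K (tag X).1 (tag X).2 := by
      have := (mem_bondsIn_iff.mp hb).1
      simpa using this
    exact Finset.mem_filter.mpr ⟨Finset.mem_univ _, b.src, h1, rfl⟩
  · intro X y hy y' hy'
    exact diamFoot_le D hEnl hr hM1 hCD hLC.1 hk (hlvl X).2.1 (hDiam (tag X).1 (hlvl X).1 (hlvl X).2.1) (hlvl X).2.2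
      (Finset.mem_filter.mp hy).2 (Finset.mem_filter.mp hy').2
  · intro X W hW
    have hmem := hlvl X
    have hsz := hts.2 K k (D.triv K k) W hk (hadm K k W hk hW) (tag X).1 hmem.1 hmem.2.1 (tag X).2 hmem.2.2
    refine hsz.trans ?_
    show C * Real.exp (-κ₁ * D.treeLen K (tag X).1 (tag X).2) * θBal F.L γ b₀ p₀ (K - k + 1) ^ 2 * (((F.L : ℝ) ^ (k - (tag X).1))⁻¹) ^ 4 ≤
      wt X * Real.exp (-(κ₁ * D.treeLen K (tag X).1 (tag X).2))
    rw [hwt]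
    have hexp : 0 ≤ Real.exp (-κ₁ * D.treeLen K (tag X).1 (tag X).2) := Real.exp_nonneg _
    have hθ2 : 0 ≤ θBal F.L γ b₀ p₀ (K - k + 1) ^ 2 := sq_nonneg _
    have hL4 : 0 ≤ (((F.L : ℝ) ^ (k - (tag X).1))⁻¹) ^ 4 := by positivity
    calc C * Real.exp (-κ₁ * D.treeLen K (tag X).1 (tag X).2) * θBal F.L γ b₀ p₀ (K - k + 1) ^ 2 * (((F.L : ℝ) ^ (k - (tag X).1))⁻¹) ^ 4
        ≤ max C 0 * Real.exp (-κ₁ * D.treeLen K (tag X).1 (tag X).2) * θBal F.L γ b₀ p₀ (K - k + 1) ^ 2 * (((F.L : ℝ) ^ (k - (tag X).1))⁻¹) ^ 4 := by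
          gcongr; exact le_max_left C 0
      _ = max C 0 * θBal F.L γ b₀ p₀ (K - k + 1) ^ 2 * (((F.L : ℝ) ^ (k - (tag X).1))⁻¹) ^ 4 * Real.exp (-(κ₁ * D.treeLen K (tag X).1 (tag X).2)) := by
          rw [neg_mul]; ring
  · intro y
    show ∑ X ∈ Finset.univ.filter (fun X => y ∈ Finset.univ.filter (fun y => ∃ z ∈ D.enl K (tag X).1 (tag X).2, iterBlockOf k z = y)),
        wt X * Real.exp (-(κ₁ * D.treeLen K (tag X).1 (tag X).2)) ≤
      max C 0 * θBal F.L γ b₀ p₀ (K - k + 1) ^ 2 * (2 * max C' 0 * (7 + 2 * r + 18 * M₁) ^ 3)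
    have hcnt := coverShape_of_alpha D hLC hEnl hr hM1 hMdvd hk hBU y
    set g : (Σ _ : ℕ, Set (Site (F.P K) 0)) → ℝ := fun x =>
      if ∃ z ∈ D.enl K x.1 x.2, iterBlockOf k z = y then (((F.L : ℝ) ^ (k - x.1))⁻¹) ^ 4 * Real.exp (-κ₁ * D.treeLen K x.1 x.2) else 0 with hg
    have hsum : ∑ X ∈ Finset.univ.filter (fun X => y ∈ Finset.univ.filter (fun y => ∃ z ∈ D.enl K (tag X).1 (tag X).2, iterBlockOf k z = y)),
          wt X * Real.exp (-(κ₁ * D.treeLen K (tag X).1 (tag X).2)) =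
        max C 0 * θBal F.L γ b₀ p₀ (K - k + 1) ^ 2 * ∑ X : Fin s.card, g (tag X) := by
      rw [Finset.mul_sum, Finset.sum_filter]
      refine Finset.sum_congr rfl fun X _ => ?_
      simp only [Finset.mem_filter, Finset.mem_univ, true_and, hg, hwt]
      split_ifs with h
      · rw [neg_mul]; ring
      · ring
    rw [hsum, sum_equivFin_symm_eq s g, hs, ← Finset.sum_filter]
    exact mul_le_mul_of_nonneg_left hcnt (by positivity)
  · -- lower: (47′) for `ρ` on the window, `χ = 1` there, main term = `β_K·A(Umin)`, times `e^{E_k}`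
    intro W hW
    show Real.exp (-((F.scheme ℰp γ).β K * wilsonAction4 (D.Umin K k (D.triv K k) W)) +
        (∑ X : Fin s.card, D.Pterm K (tag X).1 (tag X).2 (D.Umin K k (D.triv K k) W)) + 0 - D.Rm K k) ≤ Real.exp (D.Ecst K k) * ρ W
    rw [hact W]
    have h := h47ρ W hW
    have hlow : D.low K k W = Real.exp (-(D.mainT K k (D.triv K k) W) + D.Pint K k (D.triv K k) W) := by
      unfold AlphaDataT3.low; rw [hχ1 W hW, one_mul]
    rw [hlow, ← Real.exp_add, hM K k (D.triv K k) W] at h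
    have hE : 0 < Real.exp (D.Ecst K k) := Real.exp_pos _
    calc Real.exp (-((F.scheme ℰp γ).β K * wilsonAction4 (D.Umin K k (D.triv K k) W)) + D.Pint K k (D.triv K k) W + 0 - D.Rm K k)
        = Real.exp (D.Ecst K k) * Real.exp (-(D.Ecst K k) - D.Rm K k +
            (-((F.scheme ℰp γ).β K * wilsonAction4 (D.Umin K k (D.triv K k) W)) + D.Pint K k (D.triv K k) W)) := by
          rw [← Real.exp_add]; congr 1; ring
      _ ≤ Real.exp (D.Ecst K k) * ρ W := mul_le_mul_of_nonneg_left h hE.le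
  · -- upper: (41′) for `ρ` on the window, `χ ≤ 1`, times `e^{E_k}`
    intro W hW
    show Real.exp (D.Ecst K k) * ρ W ≤
      Real.exp (-((F.scheme ℰp γ).β K * wilsonAction4 (D.Umin K k (D.triv K k) W)) +
        (∑ X : Fin s.card, D.Pterm K (tag X).1 (tag X).2 (D.Umin K k (D.triv K k) W)) + 0 + D.Rm K k) +
        Real.exp (D.Ecst K k) * (Real.exp (-(D.Ecst K k) + D.Rm K k) * (D.up K k W - D.low K k W))
    rw [hact W]
    have h := h41ρ W hW
    have hlow : D.low K k W ≤ Real.exp (-(D.mainT K k (D.triv K k) W) + D.Pint K k (D.triv K k) W) := by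
      unfold AlphaDataT3.low
      have h1 := (hχ K k W).2
      have h0 := Real.exp_nonneg (-(D.mainT K k (D.triv K k) W) + D.Pint K k (D.triv K k) W)
      nlinarith
    have hE : 0 < Real.exp (D.Ecst K k) := Real.exp_pos _
    have hE' : 0 ≤ Real.exp (-(D.Ecst K k) + D.Rm K k) := Real.exp_nonneg _
    have hup : ρ W ≤ Real.exp (-((F.scheme ℰp γ).β K * wilsonAction4 (D.Umin K k (D.triv K k) W)) + D.Pint K k (D.triv K k) W +
        (-D.Ecst K k) + D.Rm K k) + Real.exp (-(D.Ecst K k) + D.Rm K k) * (D.up K k W - D.low K k W) := by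
      calc ρ W ≤ Real.exp (-(D.Ecst K k) + D.Rm K k) * D.up K k W := h
        _ = Real.exp (-(D.Ecst K k) + D.Rm K k) * D.low K k W + Real.exp (-(D.Ecst K k) + D.Rm K k) * (D.up K k W - D.low K k W) := by ring
        _ ≤ Real.exp (-(D.Ecst K k) + D.Rm K k) * Real.exp (-(D.mainT K k (D.triv K k) W) + D.Pint K k (D.triv K k) W) +
              Real.exp (-(D.Ecst K k) + D.Rm K k) * (D.up K k W - D.low K k W) := by gcongr
        _ = _ := by rw [← Real.exp_add, hM K k (D.triv K k) W]; ring_nf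
    calc Real.exp (D.Ecst K k) * ρ W
        ≤ Real.exp (D.Ecst K k) *
            (Real.exp (-((F.scheme ℰp γ).β K * wilsonAction4 (D.Umin K k (D.triv K k) W)) + D.Pint K k (D.triv K k) W + (-D.Ecst K k) + D.Rm K k) +
              Real.exp (-(D.Ecst K k) + D.Rm K k) * (D.up K k W - D.low K k W)) := mul_le_mul_of_nonneg_left hup hE.le
      _ = Real.exp (-((F.scheme ℰp γ).β K * wilsonAction4 (D.Umin K k (D.triv K k) W)) + D.Pint K k (D.triv K k) W + 0 + D.Rm K k) +
            Real.exp (D.Ecst K k) * (Real.exp (-(D.Ecst K k) + D.Rm K k) * (D.up K k W - D.low K k W)) := by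
          rw [mul_add, ← Real.exp_add]; congr 2; ring

end Summit.QuantumFields.YangMills.Theorems.FluctuationComparisonRegPrIntLS1aAlphaMemVersionOfRows

end
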